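import Literature.NumberTheory.EllipticCurves.BSDSelmerParityDokchitserBaseChangeProofs
import HarnessLib

/-!
# The quadratic-twist transport on `H¹` over ANY Galois extension containing `√c`, with the sign rule — the cohomological half of kernel brick 2 of the transport [C] (cell `b2b-bsdres`, seat additive-p1, gen 8)

HONEST FRAMING (cell `b2b-bsdres`, run/shared/lean/b2b/bsd-rank1-residual/, verbatim in every
file): the goal of the cell is to DELETE the COMBINATION-SHAPED residual classes of the
Birch–Swinnerton-Dyer formula for ALL analytic-rank `≤ 1` elliptic curves over `ℚ` — "full BSD
formula for every rank `≤ 1` curve in class `C`" assembled STRICTLY from published theorems — so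
that the rank-`≤ 1` remainder becomes exactly the CONSTRUCTION-SHAPED classes, which are TYPED
(missing-input `Prop`s), NOT attempted. This is not "finishing BSD". The additive sub-cell (seats
additive-p1…p4) is a RESEARCH ROUTE on the construction-shaped classes X3/X4; sub-cell additive-p1
= the potentially MULTIPLICATIVE additive prime (X3♯(M) / X4(M)); no claim beyond the stated
classes; the labels of X3/X4 are UNCHANGED by this file; nothing is booked.

One definition (an additive isomorphism assembled from tree isomorphisms; no predicate, no named
fact) and theorems. Context: design HOME/b2b-bsdres-additive-p1/KERNEL-C-P3.md. The transport
[C] `X(E/ℚ_∞) ≅ e_{χ} X(E♭/ℚ(μ_{p^∞}))` behind the typed input `ChiBranchLeadingTerm[Odd]At`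
(`Additive/ChiBranchInput*.lean`) factors as (i) prime-to-`p` Galois descent (kernel brick 1,
`AdditivePotMult/PrimeToPDescent.lean`, p228297) and (ii) the twist identification over the
infinite extension `F_∞ ∋ √c` (`F_∞ = ℚ(μ_{p^∞})`, `c = p*`). THIS FILE is the `H¹`-half of
(ii), in the tree's subgroup model (`H ≤ Γ_ℚ`, `L = ℚ̄^H`): for `E = W/ℚ`, `K = ℚ(θ)` quadratic
with `θ² = c`, and ANY subgroup `H ≤ galRange K` (`L ⊇ K`, e.g. `L = K·ℚ_∞`), the
Dokchitser–Dokchitser twist isomorphism `ψ = psiQ : E^{(c)}[p^∞](ℚ̄) ≃ E[p^∞](ℚ̄)` of the tree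
(`BSDSelmerParityDokchitserBaseChangeProofs`: `galRange K`-equivariant, ANTI-equivariant at the
lift `c₀` of the non-trivial automorphism of `K`) induces

* `twistSubgroupH1Equiv` — `ψ_* : H¹(H, E^{(c)}[p^∞]) ≃+ H¹(H, E[p^∞])`, i.e.
  `H¹(L, E^{(c)}[p^∞]) ≅ H¹(L, E[p^∞])` for every `L ⊇ K` ("`E^{(c)} ≅ E` over `K`");
* `twistSubgroupH1Equiv_conjH1_of_mem` — `ψ_* ∘ u_* = u_* ∘ ψ_*` for `u ∈ galRange K`
  (`Gal(ℚ̄/K)`-equivariance of the induced map, `H` normal in `Γ_ℚ`);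
* `twistSubgroupH1Equiv_conjH1_liftToAbsGal` — the SIGN RULE `ψ_* ∘ c₀_* = −c₀_* ∘ ψ_*`: the
  action of `Gal(L/ℚ)` on `H¹(L, E[p^∞])` transported to `E^{(c)}` is twisted by the quadratic
  character of `K` (T. Dokchitser 2013 §4 "`E_α ≅ E` over `K(√α)` with the Galois action twisted";
  the tree's `h1Equiv_conjH1_neg`);
* `twistSubgroupH1Equiv_mem_eigen_iff` — consequently `ψ_*` carries the `c₀_*`-INVARIANT classes
  of `H¹(L, E^{(c)}[p^∞])` onto the `c₀_*`-ANTI-invariant classes of `H¹(L, E[p^∞])` (and vice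
  versa): the `(−1)`-eigenspace bookkeeping of [C].

NOT in this file (brick 2, local half): that `ψ_*` matches the Selmer LOCAL CONDITIONS
`W'.selmerGroupOver p H ↔ W.selmerGroupOver p H` — by the tree's `mem_resKer_iff_h1Equiv_mem`
(`DiscreteH1Equiv`) this reduces to an `H_E`-equivariant isomorphism of local points
`E^{(c)}(ℚ̄_v) ≃ E(ℚ̄_v)` compatible with `ψ` under `pointsMapOfEmb` (design §2 of KERNEL-C-P3.md).

References: T. Dokchitser, *Notes on the parity conjecture* (2013) §4 [Dokchitser2013ParityNotes];
T. Dokchitser, V. Dokchitser, Ann. of Math. 172 (2010), Lemma 4.14 (proof)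
[DokchitserDokchitserAnnals2010]; R. Greenberg, LNM 1716 (1999), §5 p. 143 [GreenbergLNM1716].
-/

noncomputable section

open scoped Classical

namespace Summit.BirchSwinnertonDyer.Rank1Residual.AdditivePotMult

open Literature.NumberTheory.EllipticCurves Literature.NumberTheory.GaloisRepresentations
  WeierstrassCurve

variable (W : WeierstrassCurve ℚ) (K : Type) [Field K] [NumberField K]
  (h2 : Module.finrank ℚ K = 2) {θ : K} {c : ℚ} (hθ : θ ∉ Set.range (algebraMap ℚ K))
  (hc : θ ^ 2 = algebraMap ℚ K c) (p : ℕ)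
  (H : Subgroup (Field.absoluteGaloisGroup ℚ)) (hH : H ≤ galRange (K := ℚ) K)

include hH

/-- `ψ = psiQ` is `H`-equivariant for every `H ≤ galRange K = Gal(ℚ̄/K)` (restriction of the
tree's `psiQ_smul`). [folklore] -/
theorem psiQ_smul_of_le (h : H) (m' : geomPrimaryTorsion (W.quadraticTwist c) p) :
    psiQ W K hθ hc p (h • m') = h • psiQ W K hθ hc p m' :=
  psiQ_smul W K hθ hc p ⟨(h : Field.absoluteGaloisGroup ℚ), hH h.2⟩ m'

/-- **`ψ_* : H¹(L, E^{(c)}[p^∞]) ≃+ H¹(L, E[p^∞])` for every `L = ℚ̄^H ⊇ K = ℚ(√c)`** (subgroup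
model, `H ≤ galRange K`): the map induced on continuous cohomology by the `H`-equivariant twist
isomorphism `ψ : E^{(c)}[p^∞] ≃ E[p^∞]` (the tree's `h1Equiv` of `psiQ`). For `H` the absolute
Galois group of `K·ℚ_∞` (resp. of `ℚ(μ_{p^∞})`, `c = p*`) this is the `H¹`-level twist step of
[C]. T. Dokchitser 2013, §4. [cite: Dokchitser2013ParityNotes, §4] -/
def twistSubgroupH1Equiv : (W.quadraticTwist c).subgroupH1 p H ≃+ W.subgroupH1 p H :=
  h1Equiv (G := H) (psiQ W K hθ hc p) (psiQ_smul_of_le W K hθ hc p H hH)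

/-- Unfolding: `twistSubgroupH1Equiv` is `resH1Hom (id_H, ψ)`. [folklore] -/
theorem twistSubgroupH1Equiv_apply (ξ' : (W.quadraticTwist c).subgroupH1 p H) :
    twistSubgroupH1Equiv W K hθ hc p H hH ξ' =
      resH1Hom (ContinuousMonoidHom.id H)
        (psiQ W K hθ hc p : geomPrimaryTorsion (W.quadraticTwist c) p →+ geomPrimaryTorsion W p)
        (psiQ_smul_of_le W K hθ hc p H hH) ξ' :=
  rfl

variable [H.Normal]

/-- **Equivariance on `Gal(ℚ̄/K)`**: `ψ_* (u_* ξ') = u_* (ψ_* ξ')` for `u ∈ galRange K` (`H`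
normal in `Γ_ℚ`, `u_*` the conjugation action `conjH1`): on cocycles both sides are
`n ↦ ψ (u • f(u⁻¹ n u)) = u • ψ (f(u⁻¹ n u))`. [folklore] -/
theorem twistSubgroupH1Equiv_conjH1_of_mem {u : Field.absoluteGaloisGroup ℚ}
    (hu : u ∈ galRange (K := ℚ) K) (ξ' : (W.quadraticTwist c).subgroupH1 p H) :
    twistSubgroupH1Equiv W K hθ hc p H hH ((W.quadraticTwist c).conjH1 p H u ξ') =
      W.conjH1 p H u (twistSubgroupH1Equiv W K hθ hc p H hH ξ') := by
  obtain ⟨f, rfl⟩ := oneCocycleClass_surjective _ ξ'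
  change h1Equiv _ _ (conjH1 H _ u _) = conjH1 H _ u (h1Equiv _ _ _)
  rw [conjH1_oneCocycleClass, h1Equiv_apply, h1Equiv_apply, resH1Hom_id_oneCocycleClass,
    resH1Hom_id_oneCocycleClass, conjH1_oneCocycleClass]
  congr 1
  apply Subtype.ext
  ext n : 1
  rw [contOneCocycles.push_apply, conjCocycle_apply]
  change psiQ W K hθ hc p (u • f.1 (subgroupConj H u n)) =
    (conjCocycle H u (contOneCocycles.push
      (psiQ W K hθ hc p : geomPrimaryTorsion (W.quadraticTwist c) p →+ geomPrimaryTorsion W p)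
      (psiQ_smul_of_le W K hθ hc p H hH) f)).1 n
  rw [conjCocycle_apply, contOneCocycles.push_apply]
  exact psiQ_smul W K hθ hc p ⟨u, hu⟩ _

/-- **The sign rule `ψ_* (c₀_* ξ') = −c₀_* (ψ_* ξ')`** for the lift `c₀ = liftToAbsGal K σ₀` of the
non-trivial automorphism `σ₀ : θ ↦ −θ` of `K`: the Galois action on `E^{(c)}` is that on `E`
twisted by the quadratic character of `K` (the tree's `h1Equiv_conjH1_neg` with
`psiQ_smul_liftToAbsGal`). T. Dokchitser 2013, §4 ("`E_α ≅ E` over `K(√α)`", Galois action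
twisted). [cite: Dokchitser2013ParityNotes, §4] -/
theorem twistSubgroupH1Equiv_conjH1_liftToAbsGal (ξ' : (W.quadraticTwist c).subgroupH1 p H) :
    twistSubgroupH1Equiv W K hθ hc p H hH
        ((W.quadraticTwist c).conjH1 p H (liftToAbsGal (K := ℚ) K (sigmaQ K h2 hθ hc)) ξ') =
      -W.conjH1 p H (liftToAbsGal (K := ℚ) K (sigmaQ K h2 hθ hc))
        (twistSubgroupH1Equiv W K hθ hc p H hH ξ') :=
  h1Equiv_conjH1_neg (N := H) (psiQ W K hθ hc p) (psiQ_smul_of_le W K hθ hc p H hH)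
    (psiQ_smul_liftToAbsGal W K h2 hθ hc p) ξ'

/-- **Eigenspace bookkeeping of [C].** For `ε = ±1`: `ξ'` satisfies `c₀_* ξ' = ε ξ'` iff
`ψ_* ξ'` satisfies `c₀_* (ψ_* ξ') = −ε (ψ_* ξ')`; in particular the `c₀_*`-invariant classes of
`H¹(L, E^{(c)}[p^∞])` (those coming from `ℚ̄^{H ⊔ c₀} `, the Galois descent of brick 1) correspond
to the `(−1)`-eigenclasses of `H¹(L, E[p^∞])`. [folklore] -/
theorem twistSubgroupH1Equiv_mem_eigen_iff (ε : ℤ) (ξ' : (W.quadraticTwist c).subgroupH1 p H) :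
    (W.quadraticTwist c).conjH1 p H (liftToAbsGal (K := ℚ) K (sigmaQ K h2 hθ hc)) ξ' = ε • ξ' ↔
      W.conjH1 p H (liftToAbsGal (K := ℚ) K (sigmaQ K h2 hθ hc))
          (twistSubgroupH1Equiv W K hθ hc p H hH ξ') =
        -(ε • twistSubgroupH1Equiv W K hθ hc p H hH ξ') := by
  have hsign := twistSubgroupH1Equiv_conjH1_liftToAbsGal W K h2 hθ hc p H hH ξ'
  constructor
  · intro h
    rw [h, map_zsmul] at hsign
    rw [hsign, neg_neg]
  · intro h
    apply (twistSubgroupH1Equiv W K hθ hc p H hH).injective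
    rw [map_zsmul, hsign, h, neg_neg]

/-- **Invariants ↔ anti-invariants** (`ε = 1`): `c₀_* ξ' = ξ'` iff `c₀_* (ψ_* ξ') = −ψ_* ξ'`.
[folklore] -/
theorem conjH1_eq_self_iff_conjH1_twist_eq_neg (ξ' : (W.quadraticTwist c).subgroupH1 p H) :
    (W.quadraticTwist c).conjH1 p H (liftToAbsGal (K := ℚ) K (sigmaQ K h2 hθ hc)) ξ' = ξ' ↔
      W.conjH1 p H (liftToAbsGal (K := ℚ) K (sigmaQ K h2 hθ hc))
          (twistSubgroupH1Equiv W K hθ hc p H hH ξ') =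
        -twistSubgroupH1Equiv W K hθ hc p H hH ξ' := by
  simpa only [one_zsmul] using twistSubgroupH1Equiv_mem_eigen_iff W K h2 hθ hc p H hH 1 ξ'

end Summit.BirchSwinnertonDyer.Rank1Residual.AdditivePotMult

end
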